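import Summits.CriticalPhenomena.PercolationContinuityZ3.Theorems.PercNearOneGluingNoHeavyLowerTailSahiE4UnionRowFacts
import Summits.CriticalPhenomena.PercolationContinuityZ3.Theorems.PercNearOneGluingNoHeavyLowerTailSahiE4UnionPartialMeasure
import Mathlib.Tactic.LinearCombination
import HarnessLib

/-!
# `NoHeavyLowerTail` (crux stmt-CriticalPhenomena-4575), Sahi programme P4, ORDER 4: `E₄ ≥ 0` is preserved when an independent positively
# associated PAIR is OR-ed into two of four members — LATTICE level (all Harris rows discharged)

Support file (cell `prim-l12`, seat P4, generation 34; `--supports stmt-CriticalPhenomena-4575`).  No definitions, no named facts, no sorries;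
standard axioms.  `γ, β` finite preorders with probability weights `μ, ν` Sahi-positive of order 2 (positively associated; [Sahi2008, §2],
Literature `sahiPositive_two_iff_fkg`); `a : Fin 4 → γ → [0,1]`, `b : Fin 4 → β → [0,1]` monotone with `b_2 = b_3 = 0`; `u_i = a_i ⊕ b_i` on `γ × β`.
THEOREM `sahiE_four_orPair_nonneg_of_sahiPositive_two`: if `E₃(a_1,a_2,a_3), E₃(a_0,a_2,a_3) ≥ 0`, the product row `E₃(a_0a_1,a_2,a_3) ≥ 0` and
`E₄(a) ≥ 0` (all instances of Sahi's `C₃`, `C₄` on `γ` [Sahi2008, eq. (7); LiebSahi2021, Def. 3.1]), then `E₄^{μ⊗ν}(u) ≥ 0` — NO hypothesis on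
the pair `(b_0,b_1)` beyond positive association of `ν`.  Proof: `…PartialMeasure.sahiE_four_orPair_nonneg` with the Harris rows from
`SahiE4UnionHold.rowH_…`.  With the product-row files (`…SahiE3ProductRowUnionLattice`) and generation 32's OR theorem this is the step of a
pair-block induction ("every independent block feeds at most two members") — assembled separately.  HONEST FRAMING: two members at a time;
the four-member statement (conjecture O4) is work in progress. [this work]
-/

noncomputable section

namespace Summit.CriticalPhenomena.PercolationContinuityZ3.Theorems.SahiE4UnionPartial

open Finset Function Literature.Combinatorics.Sahi2008
open Summit.CriticalPhenomena.PercolationContinuityZ3.Theorems.SahiE4UnionHold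

variable {γ β : Type*} [Fintype γ] [Fintype β] [Preorder γ] [Preorder β]

/-- **Order-4 OR step, two members, lattice level.**  See the module docstring. [this work] -/
theorem sahiE_four_orPair_nonneg_of_sahiPositive_two (μ : γ → ℝ) (ν : β → ℝ)
    (hμ0 : ∀ t, 0 ≤ μ t) (hμ1 : ∑ t, μ t = 1) (hν0 : ∀ t, 0 ≤ ν t) (hν1 : ∑ t, ν t = 1) (hμ2 : SahiPositive μ 2) (hν2 : SahiPositive ν 2)
    (a : Fin 4 → γ → ℝ) (b : Fin 4 → β → ℝ) (ha0 : ∀ i t, 0 ≤ a i t) (ha1 : ∀ i t, a i t ≤ 1) (ham : ∀ i, Monotone (a i))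
    (hb0 : ∀ i t, 0 ≤ b i t) (hb1 : ∀ i t, b i t ≤ 1) (hbm : ∀ i, Monotone (b i)) (hbz2 : ∀ t, b 2 t = 0) (hbz3 : ∀ t, b 3 t = 0)
    (he123 : 0 ≤ sahiE μ 3 ![a 1, a 2, a 3]) (he023 : 0 ≤ sahiE μ 3 ![a 0, a 2, a 3]) (hP : 0 ≤ sahiE μ 3 ![a 0 * a 1, a 2, a 3])
    (he4 : 0 ≤ sahiE μ 4 a) :
    0 ≤ sahiE (fun p : γ × β => μ p.1 * ν p.2) 4 (fun (i : Fin 4) (p : γ × β) => a i p.1 + b i p.2 - a i p.1 * b i p.2) := by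
  have hk23 : ex μ (a 2) * ex μ (a 3) ≤ ex μ (a 2 * a 3) := by linear_combination rowH_2_3 μ hμ2 a ha0 ham
  have hC2 : ex μ (a 2) * ex μ (a 0 * a 1 * a 3) ≤ ex μ (a 0 * a 1 * a 2 * a 3) := by linear_combination rowH_2_013 μ hμ2 a ha0 ham
  have hC3 : ex μ (a 3) * ex μ (a 0 * a 1 * a 2) ≤ ex μ (a 0 * a 1 * a 2 * a 3) := by linear_combination rowH_012_3 μ hμ2 a ha0 ham
  have hl01 : ex ν (b 0) * ex ν (b 1) ≤ ex ν (b 0 * b 1) := by linear_combination rowH_0_1 ν hν2 b hb0 hbm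
  exact sahiE_four_orPair_nonneg μ ν hμ0 hμ1 hν0 hν1 a b ha0 ha1 hb0 hb1 hbz2 hbz3 hk23 hC2 hC3 he123 he023 hP he4 hl01

end Summit.CriticalPhenomena.PercolationContinuityZ3.Theorems.SahiE4UnionPartial

end
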